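import Summits.Ventures.WeilGRH.ZetaFlatTest
import Summits.Ventures.WeilGRH.TwistedFlatTestFloor
import Summits.Ventures.WeilGRH.TwistedModulationCost
import Mathlib.NumberTheory.DirichletCharacter.Orthogonality
import Mathlib.RingTheory.RootsOfUnity.AlgebraicallyClosed
import Mathlib.Analysis.Complex.Polynomial.Basic
import HarnessLib

/-!
# GRH arm (rh-explicit, venture WeilGRH): the CHARACTER-FAMILY form of the flat-window inequality —
  Odlyzko's discriminant constants and the primes `≡ 1 (mod q)` below the horizon

Cell `rh-explicit`, WEIL TRACK (structure seat weil-3, gen8).  Sequel of `TwistedFlatTest.lean`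
(`WeilPositivityOnChar χ a ⟹ 2S_χ(a) + K_κ − I_κ(a)/a ≤ log q`, one LINEAR inequality in the key
`(Re χ(n))_{n<e^{2a}}` per character) and `ZetaFlatTest.lean` (the `q = 1` companion, the pole paying
`16 sinh²(a/2)/a`).  Here the inequalities are SUMMED OVER THE GROUP of Dirichlet characters mod `q`:
orthogonality (`Σ_χ χ(n) = φ(q)·𝟙[n ≡ 1 (q)]`, Mathlib's `DirichletCharacter.sum_characters_eq`) turns
the prime term into a NON-NEGATIVE multiple of the smoothed count of the prime powers `≡ 1 (mod q)`
below the horizon `e^{2a}` — the primes that split completely in `ℚ(ζ_q)` — so that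

* `characterFamily_flatWindow_le`: if `WeilPositivityOn a` and `WeilPositivityOnChar χ a` for every
  non-principal `χ` mod `q`, then
  `2φ(q)·Σ_{log n<2a, n≡1 (q)} Λ(n)n^{-1/2}(1 − log n/(2a)) + Σ_χ (K_{κ(χ)} − I_{κ(χ)}(a)/a)`
  `≤ (φ(q) − 1)·log q + 16 sinh²(a/2)/a`;
* with numbers (`characterFamily_flatWindow_floor_le`, `q ≥ 3`: half the characters are even, half odd,
  `K₀ ≥ 5.3716`, `K₁ ≥ 2.23`, `I_κ ≤ 5`):
  `2φ(q)·Σ_{n≡1} … + φ(q)·(3.8008 − 5/a) ≤ (φ(q) − 1)·log q + 16 sinh²(a/2)/a`.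

Two readings.  (1) DISCRIMINANT (`log_level_ge_of_characterFamily`): dropping the primes,
`(φ(q) − 1) log q ≥ φ(q)(3.8008 − 5/a) − 16 sinh²(a/2)/a`; since `Σ_{χ≠1} log f_χ = log |d_{ℚ(ζ_q)}|`
(conductor–discriminant formula) and `3.8008… = (K₀ + K₁)/2 = log 8π + γ`, this is the shape of
ODLYZKO's GRH lower bound `|d_K|^{1/n_K} ≥ 8πe^γ − o(1) = 44.76…` for totally complex fields, reached from
the rungs of the positivity ladder at ONE window (Odlyzko 1975–77 / Poitou 1977 / Serre use compactly
supported test functions in Weil's explicit formula for `ζ_K` under GRH; the even characters alone give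
`K₀ = log 8π + γ + π/2`, i.e. `8πe^{γ+π/2} = 215.3…`, the totally real constant — `EvenCharacterFamilyFlatTest`).
So the GRH arm's «uniform conductor floors» are the conductor-aspect form of the Odlyzko–Serre bounds.
(2) SPLIT PRIMES / PRIMES `≡ 1 (mod q)` (`splitPrimes_flatSum_le_of_characterFamily`): the rungs at one
window bound the smoothed `n^{-1/2}`-weighted count of prime powers `≡ 1 (mod q)` below `e^{2a}` by
`[(φ(q) − 1) log q + 16 sinh²(a/2)/a]/(2φ(q)) − (3.8008 − 5/a)/2` — the one-sided square-root-strength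
prime number theorem for the progression `1 mod q` (main term `8(√x − 2 + x^{-1/2})/log x` shared among
`φ(q)` classes, plus the Brun–Titchmarsh-type `(log q)/2`), by POSITIVITY; under `RH` and `GRH` for the
characters of a prime modulus `p` it holds at every window (`…_of_grh`).

No definitions, no named facts, RH/GRH-free except the `_of_grh` corollary (hypotheses).

## References

* A. M. Odlyzko, *Lower bounds for discriminants of number fields* I/II, Acta Arith. 29 (1976) 275–297,
  Tôhoku Math. J. 29 (1977) 209–216; *Bounds for discriminants and related estimates for class numbers,
  regulators and zeros of zeta functions: a survey of recent results*, Sém. Théor. Nombres Bordeaux 2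
  (1990) 119–141, (2.5)–(2.8) (GRH: `8πe^γ`, `8πe^{γ+π/2}`). [Odlyzko1990Bounds]
* G. Poitou, *Minorations de discriminants (d'après A. M. Odlyzko)*, Sém. Bourbaki 479 (1975/76);
  *Sur les petits discriminants*, Sém. DPP 18 (1976/77) no. 6 (the explicit-formula method with compactly
  supported test functions). [Poitou1977Discriminants]
* A. Weil, *Sur les "formules explicites" de la théorie des nombres premiers* (1952), (11) pp. 261–262.
  [Weil1952FormulesExplicites]
* H. L. Montgomery, R. C. Vaughan, *Multiplicative Number Theory I* (2007), §4.3 (orthogonality), §13.2.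
  [MontgomeryVaughan2007]
-/

set_option autoImplicit false

noncomputable section

open Complex Filter Set MeasureTheory
open scoped Real Topology ComplexConjugate ArithmeticFunction.vonMangoldt

namespace Summit.Ventures.WeilGRH

open Literature.NumberTheory.LFunctions

variable {q : ℕ} {a : ℝ}

/-! ## Orthogonality, real parts, the principal character -/

/-- **Orthogonality, real part**: `Re Σ_χ χ(x) = φ(q)` if `x = 1` in `ZMod q`, else `0`
(Mathlib's `DirichletCharacter.sum_characters_eq` over `ℂ`). -/
theorem re_sum_characters_apply [NeZero q] (x : ZMod q) :
    (∑ χ : DirichletCharacter ℂ q, χ x).re = if x = 1 then (q.totient : ℝ) else 0 := by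
  rw [DirichletCharacter.sum_characters_eq]
  split_ifs <;> simp

/-- There are `φ(q)` Dirichlet characters mod `q` with values in `ℂ`. -/
theorem card_dirichletCharacter_eq_totient [NeZero q] :
    (Finset.univ : Finset (DirichletCharacter ℂ q)).card = q.totient := by
  rw [Finset.card_univ, ← Nat.card_eq_fintype_card]
  exact DirichletCharacter.card_eq_totient_of_hasEnoughRootsOfUnity ℂ q

/-- The principal character is even: `charParity 1 = 0`. -/
theorem charParity_one [NeZero q] : charParity (1 : DirichletCharacter ℂ q) = 0 :=
  charParity_of_even (MulChar.one_apply (isUnit_one.neg))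

/-- The real part of the principal character lies in `[0, 1]`: it is `1` on units and `0` elsewhere. -/
theorem re_one_apply_mem_Icc (x : ZMod q) :
    ((1 : DirichletCharacter ℂ q) x).re ∈ Icc (0 : ℝ) 1 := by
  by_cases hx : IsUnit x
  · rw [MulChar.one_apply hx]; simp
  · rw [MulChar.map_nonunit _ hx]; simp

/-! ## The principal slot: `ζ`'s flat-window inequality in the character vocabulary -/

/-- **The principal slot.**  `WeilPositivityOn a` (the `ζ` rung) gives the flat-window inequality of
`ZetaFlatTest.lean` with the pole `16 sinh²(a/2)/a` on the right; written with the principal character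
`1` mod `q` on the prime side (`Re 1(n) = 𝟙[(n,q) = 1] ≤ 1`: the prime powers dividing `q` are dropped,
each term being `≥ 0`) and the parity-`0` constants, it reads
`2Σ_{log n<2a} Λ(n)n^{-1/2}(1 − log n/(2a)) Re 1(n) + K₀ − I₀(a)/a ≤ 16 sinh²(a/2)/a`. -/
theorem principal_flatWindow_le_of_weilPositivityOn [NeZero q] (ha : 0 < a) (hW : WeilPositivityOn a) :
    2 * (∑ n ∈ weilPrimeIndex a, (Λ n : ℝ) / Real.sqrt n *
          ((1 - Real.log n / (2 * a)) * ((1 : DirichletCharacter ℂ q) (n : ZMod q)).re)) +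
        (Real.log (4 * π) + Real.eulerMascheroniConstant +
          2 * ∫ t in Ioi (0 : ℝ), weilKillingDensityPar (charParity (1 : DirichletCharacter ℂ q)) t) -
        1 / a * ∫ t in Ioi (0 : ℝ),
          weilArchDensityPar (charParity (1 : DirichletCharacter ℂ q)) t * min t (2 * a) ≤
      16 * Real.sinh (a / 2) ^ 2 / a := by
  have hζ := zetaFlatWindow_le_of_weilPositivityOn ha hW
  rw [charParity_one,
    show (fun t ↦ weilKillingDensityPar 0 t) = fun t ↦ (Real.exp (t / 2) - 1) / (2 * Real.sinh t) from
      funext weilKillingDensityPar_zero_eq,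
    show (fun t ↦ weilArchDensityPar 0 t * min t (2 * a)) = fun t ↦ weilArchDensity t * min t (2 * a) from
      funext fun t ↦ by rw [weilArchDensityPar_zero_apply]]
  have hsum : ∑ n ∈ weilPrimeIndex a, (Λ n : ℝ) / Real.sqrt n *
        ((1 - Real.log n / (2 * a)) * ((1 : DirichletCharacter ℂ q) (n : ZMod q)).re) ≤
      ∑ n ∈ weilPrimeIndex a, (Λ n : ℝ) / Real.sqrt n * (1 - Real.log n / (2 * a)) := by
    refine Finset.sum_le_sum fun n hn ↦ ?_
    have h0 := flatSum_term_nonneg ha hn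
    obtain ⟨h1, h2⟩ := re_one_apply_mem_Icc (q := q) (n : ZMod q)
    calc (Λ n : ℝ) / Real.sqrt n * ((1 - Real.log n / (2 * a)) * ((1 : DirichletCharacter ℂ q) (n : ZMod q)).re)
        = (Λ n : ℝ) / Real.sqrt n * (1 - Real.log n / (2 * a)) *
            ((1 : DirichletCharacter ℂ q) (n : ZMod q)).re := by ring
      _ ≤ (Λ n : ℝ) / Real.sqrt n * (1 - Real.log n / (2 * a)) * 1 :=
          mul_le_mul_of_nonneg_left h2 h0
      _ = _ := mul_one _
  linarith

/-- **Every slot.**  Under the family hypothesis (`ζ` rung + a rung for every non-principal `χ` mod `q`)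
EVERY character mod `q` satisfies the flat-window inequality with right-hand side
`B(χ) = 16 sinh²(a/2)/a` for `χ = 1` and `log q` otherwise. -/
theorem flatWindow_le_slot [NeZero q] (hq : q ≠ 1) (ha : 0 < a) (hζ : WeilPositivityOn a)
    (hχ : ∀ χ : DirichletCharacter ℂ q, χ ≠ 1 → WeilPositivityOnChar χ a)
    (χ : DirichletCharacter ℂ q) :
    2 * (∑ n ∈ weilPrimeIndex a, (Λ n : ℝ) / Real.sqrt n *
          ((1 - Real.log n / (2 * a)) * (χ (n : ZMod q)).re)) +
        (Real.log (4 * π) + Real.eulerMascheroniConstant +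
          2 * ∫ t in Ioi (0 : ℝ), weilKillingDensityPar (charParity χ) t) -
        1 / a * ∫ t in Ioi (0 : ℝ), weilArchDensityPar (charParity χ) t * min t (2 * a) ≤
      if χ = 1 then 16 * Real.sinh (a / 2) ^ 2 / a else Real.log q := by
  split_ifs with h1
  · subst h1
    exact principal_flatWindow_le_of_weilPositivityOn ha hζ
  · exact flatWindow_le_log_of_weilPositivityOnChar hq χ ha (hχ χ h1)

/-! ## The family inequality -/

/-- **THE CHARACTER-FAMILY FLAT-WINDOW INEQUALITY.**  Let `q ≠ 1`, `a > 0`, and assume the `ζ` rung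
`WeilPositivityOn a` and the `χ` rung `WeilPositivityOnChar χ a` for EVERY non-principal character `χ`
mod `q`.  Summing the `φ(q)` flat-window inequalities and using orthogonality
(`Σ_χ Re χ(n) = φ(q)·𝟙[n ≡ 1 (q)]`):

  `2φ(q) · Σ_{log n<2a, n ≡ 1 (q)} Λ(n) n^{-1/2} (1 − log n/(2a))`
    `+ Σ_χ [K_{κ(χ)} − (1/a) I_{κ(χ)}(a)] ≤ (φ(q) − 1)·log q + 16 sinh²(a/2)/a`

(`K_κ = log 4π + γ + 2∫₀^∞(e^{(1/2−κ)t} − 1)dt/(2 sinh t)`, `I_κ(a) = ∫₀^∞ e^{(1/2−κ)t}/(2 sinh t)·min(t,2a)dt`).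
The prime powers `≡ 1 (mod q)` — those splitting completely in `ℚ(ζ_q)` — enter with the POSITIVE
weight `2φ(q)`; every other prime power has dropped out.  RH/GRH-free. -/
theorem characterFamily_flatWindow_le [NeZero q] (hq : q ≠ 1) (ha : 0 < a) (hζ : WeilPositivityOn a)
    (hχ : ∀ χ : DirichletCharacter ℂ q, χ ≠ 1 → WeilPositivityOnChar χ a) :
    2 * (q.totient : ℝ) * (∑ n ∈ (weilPrimeIndex a).filter (fun n : ℕ ↦ (n : ZMod q) = 1),
          (Λ n : ℝ) / Real.sqrt n * (1 - Real.log n / (2 * a))) +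
        ∑ χ : DirichletCharacter ℂ q,
          ((Real.log (4 * π) + Real.eulerMascheroniConstant +
              2 * ∫ t in Ioi (0 : ℝ), weilKillingDensityPar (charParity χ) t) -
            1 / a * ∫ t in Ioi (0 : ℝ), weilArchDensityPar (charParity χ) t * min t (2 * a)) ≤
      ((q.totient : ℝ) - 1) * Real.log q + 16 * Real.sinh (a / 2) ^ 2 / a := by
  classical
  -- abbreviations
  set c : ℕ → ℝ := fun n ↦ (Λ n : ℝ) / Real.sqrt n * (1 - Real.log n / (2 * a)) with hc
  set K : DirichletCharacter ℂ q → ℝ := fun χ ↦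
    (Real.log (4 * π) + Real.eulerMascheroniConstant +
        2 * ∫ t in Ioi (0 : ℝ), weilKillingDensityPar (charParity χ) t) -
      1 / a * ∫ t in Ioi (0 : ℝ), weilArchDensityPar (charParity χ) t * min t (2 * a) with hK
  set B : DirichletCharacter ℂ q → ℝ := fun χ ↦
    if χ = 1 then 16 * Real.sinh (a / 2) ^ 2 / a else Real.log q with hB
  -- every slot
  have hslot : ∀ χ : DirichletCharacter ℂ q,
      2 * (∑ n ∈ weilPrimeIndex a, c n * (χ (n : ZMod q)).re) + K χ ≤ B χ := by
    intro χ
    have h := flatWindow_le_slot hq ha hζ hχ χ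
    have hs : ∑ n ∈ weilPrimeIndex a, c n * (χ (n : ZMod q)).re =
        ∑ n ∈ weilPrimeIndex a, (Λ n : ℝ) / Real.sqrt n *
          ((1 - Real.log n / (2 * a)) * (χ (n : ZMod q)).re) :=
      Finset.sum_congr rfl fun n _ ↦ by simp only [hc]; ring
    rw [hs]
    simpa only [hK, hB, add_sub_assoc'] using h
  -- sum of the slots
  have hsumB : ∑ χ : DirichletCharacter ℂ q, B χ =
      ((q.totient : ℝ) - 1) * Real.log q + 16 * Real.sinh (a / 2) ^ 2 / a := by
    have hB' : ∀ χ : DirichletCharacter ℂ q,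
        B χ = Real.log q + if χ = 1 then 16 * Real.sinh (a / 2) ^ 2 / a - Real.log q else 0 := by
      intro χ
      simp only [hB]
      split_ifs <;> ring
    simp_rw [hB']
    rw [Finset.sum_add_distrib, Finset.sum_const, Finset.sum_ite_eq' Finset.univ (1 : DirichletCharacter ℂ q),
      if_pos (Finset.mem_univ _), card_dirichletCharacter_eq_totient, nsmul_eq_mul]
    ring
  have hsumP : ∑ χ : DirichletCharacter ℂ q, ∑ n ∈ weilPrimeIndex a, c n * (χ (n : ZMod q)).re =
      (q.totient : ℝ) * ∑ n ∈ (weilPrimeIndex a).filter (fun n : ℕ ↦ (n : ZMod q) = 1), c n := by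
    rw [Finset.sum_comm]
    have hin : ∀ n ∈ weilPrimeIndex a,
        ∑ χ : DirichletCharacter ℂ q, c n * (χ (n : ZMod q)).re =
          if (n : ZMod q) = 1 then (q.totient : ℝ) * c n else 0 := by
      intro n _
      rw [← Finset.mul_sum, ← Complex.re_sum, re_sum_characters_apply]
      split_ifs <;> ring
    rw [Finset.sum_congr rfl hin, ← Finset.sum_filter, ← Finset.mul_sum]
  have htot := Finset.sum_le_sum fun χ (_ : χ ∈ (Finset.univ : Finset (DirichletCharacter ℂ q))) ↦ hslot χ
  rw [Finset.sum_add_distrib, ← Finset.mul_sum, hsumP, hsumB] at htot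
  linarith

/-! ## With numbers: half the characters are even, half odd -/

open scoped Classical in
/-- For `q ≥ 3`, `Σ_χ c(χ) = 3.8008·φ(q)` where `c(χ) = 5.3716` for even and `2.23` for odd `χ`:
`c(χ) = 3.8008 + 1.5708·Re χ(−1)` and `Σ_χ χ(−1) = 0` (`−1 ≠ 1` in `ZMod q`). -/
theorem sum_parityConst_eq [NeZero q] (hq : 2 < q) :
    ∑ χ : DirichletCharacter ℂ q, (if χ.Even then (5.3716 : ℝ) else 2.23) = 3.8008 * (q.totient : ℝ) := by
  haveI : Fact (2 < q) := ⟨hq⟩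
  have hc : ∀ χ : DirichletCharacter ℂ q,
      (if χ.Even then (5.3716 : ℝ) else 2.23) = 3.8008 + 1.5708 * (χ (-1)).re := by
    intro χ
    rcases χ.even_or_odd with h | h
    · rw [if_pos h, show χ (-1) = 1 from h]; norm_num
    · rw [if_neg h.not_even, show χ (-1) = -1 from h]; norm_num
  simp_rw [hc]
  rw [Finset.sum_add_distrib, Finset.sum_const, card_dirichletCharacter_eq_totient, nsmul_eq_mul,
    ← Finset.mul_sum, ← Complex.re_sum, re_sum_characters_apply, if_neg ZMod.neg_one_ne_one]
  ring

open scoped Classical in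
/-- Per character: `K_{κ(χ)} − I_{κ(χ)}(a)/a ≥ c(χ) − 5/a` with `c = 5.3716` (even) / `2.23` (odd). -/
theorem flatWindow_archConst_ge [NeZero q] (ha : 0 < a) (χ : DirichletCharacter ℂ q) :
    (if χ.Even then (5.3716 : ℝ) else 2.23) - 5 / a ≤
      (Real.log (4 * π) + Real.eulerMascheroniConstant +
          2 * ∫ t in Ioi (0 : ℝ), weilKillingDensityPar (charParity χ) t) -
        1 / a * ∫ t in Ioi (0 : ℝ), weilArchDensityPar (charParity χ) t * min t (2 * a) := by
  have hI := integral_weilArchDensityPar_mul_min_le_five (charParity χ) ha.le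
  have hIa : 1 / a * ∫ t in Ioi (0 : ℝ), weilArchDensityPar (charParity χ) t * min t (2 * a) ≤ 5 / a := by
    rw [one_div_mul_eq_div]
    exact div_le_div_of_nonneg_right hI ha.le
  split_ifs with h
  · rw [charParity_of_even h] at hIa ⊢
    have hK := flatWindow_const_zero_ge
    linarith
  · have hK := flatWindow_const_ge χ
    linarith

/-- **THE FAMILY INEQUALITY WITH NUMBERS** (`q ≥ 3`, `a > 0`): if `WeilPositivityOn a` and
`WeilPositivityOnChar χ a` for every non-principal `χ` mod `q`, then

  `2φ(q)·Σ_{log n<2a, n≡1 (q)} Λ(n)n^{-1/2}(1 − log n/(2a)) + φ(q)·(3.8008 − 5/a)`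
    `≤ (φ(q) − 1)·log q + 16 sinh²(a/2)/a`.

Here `3.8008 ≤ (K₀ + K₁)/2 = log 8π + γ = 3.80138…`: `e^{3.8014} = 8πe^γ = 44.76…` is ODLYZKO's GRH
lower bound for the root discriminant of totally complex number fields of large degree. -/
theorem characterFamily_flatWindow_floor_le [NeZero q] (hq : 2 < q) (ha : 0 < a)
    (hζ : WeilPositivityOn a) (hχ : ∀ χ : DirichletCharacter ℂ q, χ ≠ 1 → WeilPositivityOnChar χ a) :
    2 * (q.totient : ℝ) * (∑ n ∈ (weilPrimeIndex a).filter (fun n : ℕ ↦ (n : ZMod q) = 1),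
          (Λ n : ℝ) / Real.sqrt n * (1 - Real.log n / (2 * a))) +
        (q.totient : ℝ) * (3.8008 - 5 / a) ≤
      ((q.totient : ℝ) - 1) * Real.log q + 16 * Real.sinh (a / 2) ^ 2 / a := by
  classical
  have hq1 : q ≠ 1 := by omega
  have h := characterFamily_flatWindow_le hq1 ha hζ hχ
  have hlow : ∑ χ : DirichletCharacter ℂ q, ((if χ.Even then (5.3716 : ℝ) else 2.23) - 5 / a) ≤
      ∑ χ : DirichletCharacter ℂ q,
        ((Real.log (4 * π) + Real.eulerMascheroniConstant +
            2 * ∫ t in Ioi (0 : ℝ), weilKillingDensityPar (charParity χ) t) -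
          1 / a * ∫ t in Ioi (0 : ℝ), weilArchDensityPar (charParity χ) t * min t (2 * a)) :=
    Finset.sum_le_sum fun χ _ ↦ flatWindow_archConst_ge ha χ
  rw [Finset.sum_sub_distrib, sum_parityConst_eq hq, Finset.sum_const, card_dirichletCharacter_eq_totient,
    nsmul_eq_mul] at hlow
  linarith

/-! ## Reading 1: the discriminant (Odlyzko) form -/

/-- **THE DISCRIMINANT FORM** (`q ≥ 3`): if every Dirichlet character mod `q` has its rung at the window
`a > 0` (`ζ` included), then

  `φ(q)·(3.8008 − 5/a) − 16 sinh²(a/2)/a ≤ (φ(q) − 1)·log q`.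

Since `Σ_{χ≠1 mod q} log f_χ = log |d_{ℚ(ζ_q)}| ≤ (φ(q) − 1) log q` (conductor–discriminant formula) and
`3.8008 ≈ log(8πe^γ)`, this is the shape of Odlyzko's GRH discriminant bound
`(1/n) log |d_K| ≥ log(8πe^γ) − O(1/a) − (pole term)/n` for the cyclotomic field, obtained from the rungs
of the positivity ladder at one finite window instead of GRH (numerically slack for cyclotomic fields,
whose root discriminant grows with `q`; the content is the constant).  RH/GRH-free. -/
theorem log_level_ge_of_characterFamily [NeZero q] (hq : 2 < q) (ha : 0 < a)
    (hζ : WeilPositivityOn a) (hχ : ∀ χ : DirichletCharacter ℂ q, χ ≠ 1 → WeilPositivityOnChar χ a) :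
    (q.totient : ℝ) * (3.8008 - 5 / a) - 16 * Real.sinh (a / 2) ^ 2 / a ≤
      ((q.totient : ℝ) - 1) * Real.log q := by
  have h := characterFamily_flatWindow_floor_le hq ha hζ hχ
  have hS : 0 ≤ ∑ n ∈ (weilPrimeIndex a).filter (fun n : ℕ ↦ (n : ZMod q) = 1),
      (Λ n : ℝ) / Real.sqrt n * (1 - Real.log n / (2 * a)) :=
    Finset.sum_nonneg fun n hn ↦ flatSum_term_nonneg ha (Finset.mem_of_mem_filter n hn)
  have hφ : (0 : ℝ) ≤ q.totient := Nat.cast_nonneg _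
  nlinarith

/-- **Contrapositive of the discriminant form**: for `q ≥ 3` and a window `a > 0` with
`(φ(q) − 1) log q < φ(q)(3.8008 − 5/a) − 16 sinh²(a/2)/a`, NOT every character mod `q` can have its
rung at `a` — granted the `ζ` rung, some non-principal `χ` mod `q` fails `WeilPositivityOnChar χ a`
(so, for prime `q`, `GRH` fails for some `χ` mod `q`, by `WeilPositivityChar.of_grh`).  (For a single
modulus the hypothesis is never met with these constants — the pole `16 sinh²(a/2)/a ≈ 8e^a/a` outgrows
`φ(q)·3.8` before `5/a` is small; the discriminant form records the SHAPE and the CONSTANT of Odlyzko's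
bound, whose numerical bite is on fields of small root discriminant and large degree.) -/
theorem exists_not_weilPositivityOnChar_of_log_lt [NeZero q] (hq : 2 < q) (ha : 0 < a)
    (hζ : WeilPositivityOn a)
    (hlt : ((q.totient : ℝ) - 1) * Real.log q <
      (q.totient : ℝ) * (3.8008 - 5 / a) - 16 * Real.sinh (a / 2) ^ 2 / a) :
    ∃ χ : DirichletCharacter ℂ q, χ ≠ 1 ∧ ¬ WeilPositivityOnChar χ a := by
  by_contra h
  push Not at h
  exact (not_le.2 hlt) (log_level_ge_of_characterFamily hq ha hζ h)

/-! ## Reading 2: the primes `≡ 1 (mod q)` below the horizon -/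

/-- **PRIMES `≡ 1 (mod q)` FROM POSITIVITY** (`q ≥ 3`, `a > 0`): if every character mod `q` has its rung
at `a` (`ζ` included), then the smoothed count of the prime powers `≡ 1 (mod q)` below `e^{2a}` obeys

  `Σ_{log n<2a, n≡1 (q)} Λ(n) n^{-1/2} (1 − log n/(2a))`
    `≤ [(φ(q) − 1) log q + 16 sinh²(a/2)/a]/(2φ(q)) − (3.8008 − 5/a)/2`.

With `x = e^{2a}`: `16 sinh²(a/2)/a = 8(√x − 2 + x^{-1/2})/log x`, so the right-hand side is
`4(√x − 2 + x^{-1/2})/(φ(q) log x) + (1 − 1/φ(q))(log q)/2 − 1.9004 + 5/log x`: the square-root main term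
shared equally among the `φ(q)` classes plus a Brun–Titchmarsh-type `(log q)/2` — the one-sided prime
number theorem for the progression `1 mod q` at GRH strength, from the rungs at ONE window. -/
theorem splitPrimes_flatSum_le_of_characterFamily [NeZero q] (hq : 2 < q) (ha : 0 < a)
    (hζ : WeilPositivityOn a) (hχ : ∀ χ : DirichletCharacter ℂ q, χ ≠ 1 → WeilPositivityOnChar χ a) :
    ∑ n ∈ (weilPrimeIndex a).filter (fun n : ℕ ↦ (n : ZMod q) = 1),
        (Λ n : ℝ) / Real.sqrt n * (1 - Real.log n / (2 * a)) ≤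
      (((q.totient : ℝ) - 1) * Real.log q + 16 * Real.sinh (a / 2) ^ 2 / a) / (2 * q.totient) -
        (3.8008 - 5 / a) / 2 := by
  have h := characterFamily_flatWindow_floor_le hq ha hζ hχ
  have hφ : (0 : ℝ) < q.totient := by exact_mod_cast Nat.totient_pos.2 (by omega)
  rw [le_sub_iff_add_le, le_div_iff₀ (by positivity)]
  nlinarith

/-! ## Under `RH` + `GRH` for a prime modulus: every window -/

/-- **`RH` + `GRH(χ)` for every `χ` mod a prime `p ≥ 3` ⟹ the family inequality at EVERY window**:
for all `a > 0`,
`2(p − 1)·Σ_{log n<2a, n≡1 (p)} Λ(n)n^{-1/2}(1 − log n/(2a)) + (p − 1)(3.8008 − 5/a) ≤ (p − 2) log p + 16 sinh²(a/2)/a`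
— the primes `ℓ ≡ 1 (mod p)` are counted below every horizon with square-root accuracy, one-sidedly,
through Weil POSITIVITY (`WeilPositivityChar.of_grh` — every non-principal character of prime modulus is
primitive — and `riemannHypothesis_iff_forall_weilPositivityOn`). -/
theorem characterFamily_flatWindow_floor_le_of_grh {p : ℕ} [NeZero p] (hp : p.Prime) (hp2 : 2 < p)
    (hRH : RiemannHypothesis) (hGRH : ∀ χ : DirichletCharacter ℂ p, χ ≠ 1 → χ.RiemannHypothesis)
    (ha : 0 < a) :
    2 * (p.totient : ℝ) * (∑ n ∈ (weilPrimeIndex a).filter (fun n : ℕ ↦ (n : ZMod p) = 1),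
          (Λ n : ℝ) / Real.sqrt n * (1 - Real.log n / (2 * a))) +
        (p.totient : ℝ) * (3.8008 - 5 / a) ≤
      ((p.totient : ℝ) - 1) * Real.log p + 16 * Real.sinh (a / 2) ^ 2 / a := by
  have hp1 : p ≠ 1 := hp.ne_one
  refine characterFamily_flatWindow_floor_le hp2 ha
    (riemannHypothesis_iff_forall_weilPositivityOn.1 hRH a ha) fun χ hχ ↦ ?_
  -- for a prime modulus every non-principal character is primitive (conductor `∣ p`, `≠ 1`)
  have hprim : χ.IsPrimitive := by
    rw [DirichletCharacter.isPrimitive_def]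
    rcases (Nat.dvd_prime hp).1 χ.conductor_dvd_level with h | h
    · exact absurd (DirichletCharacter.eq_one_iff_conductor_eq_one.2 h) hχ
    · exact h
  exact (WeilPositivityChar.of_grh hp1 hprim (hGRH χ hχ)).on a

end Summit.Ventures.WeilGRH

end
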